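import Summits.HodgeConjecture.Ring2.NonSimpleFivefoldsComplete
import Summits.HodgeConjecture.Ring2.CaseFFivefoldsHodge
import Summits.HodgeConjecture.CorCM.CMFivefoldsOfMarkman
import Literature.AlgebraicGeometry.Motives.AbelianVarietyPoincareSplitting
import Literature.AlgebraicGeometry.HodgeTheory.AbelianVarietyHOneHomMultiplicityFormula
import HarnessLib

/-!
# The Hodge conjecture for complex abelian varieties of dimension `≤ 5`, GRANTED Markman's theorem on the Weil classes of abelian fourfolds ALONE: every non-simple fourfold, and every non-simple fivefold outside two printed rows

Cell `pub-hodge-ring2` (HONEST FRAMING: research route conditional on HC_CM; not a corollary; Q11.4-sentence-2 already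
refuted in dim ≥ 3), Literature lane (lit seat, generation 63, programme R35). NEW as stated — a CONDITIONAL census
assembling published results —, hence under `Summits/`. Theorems only (no definition, no named fact, no `sorry`).
The ONLY standing hypothesis is `hMark : Markman2025_weilClasses_algebraic_abelianFourfold` (the tree's EXISTING named
fact: the rational `(2,2)` Weil classes of abelian fourfolds are algebraic; taken as a hypothesis, never discharged,
never restated). HC_CM does NOT appear: in dimension `≤ 5` it is itself a consequence of `hMark` (the tree's
`CorCM.CMWeights.cmHodgeHypothesisAt_of_dim_le_five_of_markman`), and that theorem is what is used below.

Moonen–Zarhin, Math. Ann. **315** (1999) (chunk p0001 [corpus: paper:arxiv-math_9901113]): case (a) «`X` is isogenous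
to a product `X₁ × X₂` where `X₁` is an elliptic curve with complex multiplication by an imaginary quadratic field `k`
and where `X₂` is a simple abelian threefold such that there exists an embedding `k ↪ End⁰(X₂)`» (L77–L81); Thm. 0.1
(fourfolds): (1) in case (a) `B•(X)` is generated by divisor classes and the Weil classes `W_k`, (4) outside (a)–(d)
`B•(Xⁿ) = D•(Xⁿ)`; cases (e) `X ∼ X₁² × X₂`, (f) `X ∼ X₀ × X₁ × X₂` (`X₀ ≁ X₁` elliptic curves), (g) `X ∼ X₁ × X₂`
with `X₂` a simple FOURFOLD (L127–L140); Thm. 0.2 (fivefolds): (2) case (f), (4) «if `X` has no simple factor of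
dimension 4 then … `B•(Xⁿ) = D•(Xⁿ)`» outside (e), (f), (g) (L150–L180); §5 (5.3): «Either (a1) `F = k`, or (a2) `F`
is a sextic CM-field» for `F = End⁰(X₂)`.

THE ASSEMBLY (every row a theorem of the tree; this file only decomposes and dispatches).
* §1 ISOGENY FACTORS (Poincaré's complete reducibility in the tree's quasi-retraction form
  `exists_complement_of_quasiRetraction`): an isogeny factor `A ≼ X` has a complement, `A × B ∼ X`
  (`exists_prod_isIsogenous_of_avDominatedBy`); homomorphisms from a simple `T` to a smaller `E` vanish; hence for an
  elliptic curve `E` and a simple threefold `T` both dominated by `X`: `dim X = 4 ⟹ X ∼ E × T`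
  (`isIsogenous_curve_prod_threefold_of_avDominatedBy_of_dim_eq_four`), `dim X = 5 ⟹ X ∼ C × (E × T)` for a curve `C`
  (`exists_isIsogenous_curve_prod_of_avDominatedBy_of_dim_eq_five`) — the passage from the cell's DOMINATION form of
  «case (a) relative to `X`» to the PRINTED isogeny shapes (a), (e), (f).
* §2 CASE (a) AND CASE (f) GRANTED `hMark` ALONE: **`hodgeConjectureFor_cmCurve_prod_simpleThreefold_of_markman`** —
  `HC(E × T)` for `E` a curve with `χ ≫ χ = -d`, `T` a simple threefold, `j : End⁰(E) →+* End⁰(T)`: by (5.3)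
  (`finrank_endAlgebra_eq_two_or_isOfCMType_of_dim_eq_three_of_ringHom`, lit g63) either `End⁰(T) = k`, and then
  Thm. 0.1 (1) read for HC (the tree's `hodgeConjectureFor_prod_cmCurve_of_unitaryTwoOne_of_weilClassesFourfold`, its
  data — an honest `φ : T ⟶ T` with `φ ≫ φ = -(M²d) = (Mχ) ≫ (Mχ)`, Shimura's multiplicities `(2,1)`/`(1,2)`, the sign
  of the curve's complex multiplication — PRODUCED here from `j`), or `T` is of CM type, and then `E × T` is a CM
  fourfold (`CMWeights.hodgeConjectureFor_of_isOfCMType_dim_le_five_of_markman`); **`hodgeConjectureFor_caseF_of_markman`**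
  — case (f) from `HC(X₁ × X₂)` by Thm. 0.2 (2) (`hodgeConjectureFor_caseF_of_dim_eq_three_of_hodgeConjectureFor`).
* §3 FOURFOLDS: **`hodgeConjectureFor_of_dim_eq_four_of_not_isSimple_of_markman`** — EVERY NON-SIMPLE complex abelian
  fourfold satisfies the Hodge conjecture granted `hMark` (outside (a): the tree's unconditional Thm. 0.1 (4),
  `NonSimpleFourfolds.isStablyNondegenerate_of_dim_eq_four_of_not_isSimple_of_not_caseA`; in (a): §1 + §2);
  `hodgeConjectureFor_of_dim_eq_four_of_markman` adds the simple fourfolds of CM type.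
* §4 FIVEFOLDS: **`hodgeConjectureFor_of_dim_eq_five_of_not_isSimple_of_markman`** — every non-simple fivefold WITHOUT
  simple isogeny factor of dimension `4` and OUTSIDE the row «`X ∼ E² × T`, `T` a simple threefold with
  `dim_ℚ End⁰(T) = 2` and `End⁰(E) ↪ End⁰(T)`» (case (e) ∩ (a1)) satisfies the Hodge conjecture granted `hMark`
  (outside (e)/(f): the tree's unconditional Thm. 0.2 (4), `NonSimpleFivefolds.hodgeConjectureFor_of_dim_eq_five_of_not_isSimple`;
  (f): §2; (e) ∩ (a2): `E² × T` is a CM fivefold).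
* §5 DIMENSION `≤ 5`: **`hodgeConjectureFor_of_dim_le_five_of_markman`** and the class target
  **`hcOnClass_dim_le_five_of_markman`**, with the on-path lemma.
WHAT IS NOT CLAIMED (the residual rows, each a printed theorem NOT yet a theorem of the tree): simple fourfolds not of
CM type (Moonen–Zarhin 1995); simple fivefolds not of CM type (Tankeev–Ribet, the tree's named fact
`TankeevRibet1983_hodgeClasses_divisorial_powers_simplePrimeDimension`); fivefolds with a simple fourfold isogeny factor
(Thm. 0.2 (3)–(4) with case (g)); case (e) with `End⁰(T) = k` (Thm. 0.2 (1): the pull-backs `W_{k,α}`). Nothing here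
discharges `hMark`; nothing is said about `D² ≠ B²`.

## References
* [MoonenZarhin1999LowDim] B. Moonen, Yu. Zarhin, Math. Ann. 315 (1999) 711–733: cases (a), (e), (f), (g), Thm. 0.1,
  Thm. 0.2, §5 (5.3)–(5.12) [corpus: paper:arxiv-math_9901113 p0001, p0008–p0011]. [cite: MoonenZarhin1999LowDim, Thm. 0.1 and Thm. 0.2]
* [MumfordAV1970] D. Mumford, *Abelian Varieties* (1970), §19 Thm. 1 and Cor. 1–2 (pp. 173–174) (Poincaré's complete
  reducibility; homomorphisms of simple abelian varieties). [cite: MumfordAV1970, §19 Thm. 1 (pp. 173–174)]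
* [Milne1999] J. S. Milne, Compositio Math. 117 (1999), §2 p. 54 (products and quotients of CM abelian varieties).
  [cite: Milne1999, §2 p. 54]
* [Markman2025SurveySecant] E. Markman, arXiv:2509.23403, Thm. 1.2 and Cor. 1.3 (Weil classes on abelian fourfolds;
  the hypothesis `hMark`). [claim: Markman2025SurveySecant, status: under-review]
* [vanGeemen1994HodgeAV] B. van Geemen, LNM 1594 (1994), Lemma 3.7 (isogeny invariance), Thm. 6.12.
  [cite: vanGeemen1994HodgeAV, Lemma 3.7]
* [Deligne2000] P. Deligne, *The Hodge conjecture* (Clay, 2000), §1. [cite: Deligne2000, §1]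
-/

noncomputable section

open CategoryTheory CategoryTheory.Limits

namespace Summit.HodgeConjecture.Ring2.LowDimOfMarkman

open Literature.AlgebraicGeometry.Motives (AbelianVariety)
open Literature.AlgebraicGeometry.Motives.AbelianVariety
open Literature.AlgebraicGeometry.HodgeTheory
open Literature.AlgebraicGeometry.ComplexMultiplication
open Literature.AlgebraicGeometry.Milne1999
open Summit.HodgeConjecture.CorCM (ne_zero_of_comp_eq_nsmul_id)
open Summit.HodgeConjecture.CorCM.Domination
open Summit.HodgeConjecture.CorCM.CMWeights (hodgeConjectureFor_of_isOfCMType_dim_le_five_of_markman)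
open Summit.HodgeConjecture.Ring2.NonSimpleFourfolds
open Summit.HodgeConjecture.Ring2.NonSimpleFivefolds
open Summit.HodgeConjecture.HodgeConjecture.Ring2.ClassTargets (HCOnClass)

variable {X A E T : AbelianVariety ℂ}

/-! ### §1 Isogeny factors: complements and the printed shapes of cases (a), (e), (f) -/

/-- **An isogeny factor has a complement**: if `A ≼ X` (`s ≫ π = [N]_A`, `N ≠ 0`), then `A × B ∼ X` for an abelian
subvariety `B` of `X` with `dim A + dim B = dim X` (Poincaré's complete reducibility in the quasi-retraction form of
the tree, `exists_complement_of_quasiRetraction`: `B = im([N]_X - π ≫ s)`). [cite: MumfordAV1970, §19 Thm. 1 (pp. 173–174)] -/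
theorem exists_prod_isIsogenous_of_avDominatedBy (h : AVDominatedBy A X) :
    ∃ B : AbelianVariety ℂ, A.dim + B.dim = X.dim ∧ AbelianVariety.IsIsogenous (A.prod B) X := by
  obtain ⟨s, π, N, hN, hsπ⟩ := h
  obtain ⟨B, j, -, -, hσ, -, hdim, -, -⟩ := exists_complement_of_quasiRetraction s π hN hsπ
  exact ⟨B, hdim, (biprodIsoProd A B).inv ≫ biprod.desc s j,
    isIsogeny_comp (isIsogeny_hom_of_iso (biprodIsoProd A B).symm) hσ⟩

/-- Homomorphisms FROM a simple abelian variety to one of smaller dimension vanish (`Hom(T, E) = 0 ⟺ Hom(E, T) = 0`,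
and a non-zero homomorphism into a simple `T` is surjective). [cite: MumfordAV1970, §19 Cor. 2 of Thm. 1 (p. 174)] -/
theorem hom_eq_zero_of_isSimple_of_lt_dim (hT : T.IsSimple) (h : E.dim < T.dim) (f : T ⟶ E) : f = 0 :=
  (Literature.AlgebraicGeometry.HodgeTheory.AbelianVariety.forall_hom_eq_zero_comm).1
    (hom_eq_zero_of_isSimple_of_dim_lt hT h) f

/-- A SIMPLE isogeny factor `T ≼ A` of the same dimension is isogenous to `A` (the projection `π : A ⟶ T` is non-zero,
hence surjective, hence an isogeny). [cite: MumfordAV1970, §19 Cor. 2 of Thm. 1 (p. 174)] -/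
theorem isIsogenous_of_avDominatedBy_of_isSimple_of_dim_eq (h : AVDominatedBy T A) (hT : T.IsSimple)
    (h0 : 0 < T.dim) (hd : A.dim = T.dim) : AbelianVariety.IsIsogenous A T := by
  obtain ⟨s, π, N, hN, hsπ⟩ := h
  exact ⟨π, isIsogeny_of_isSimple_of_ne_zero_of_dim_eq π hT (ne_zero_of_comp_eq_nsmul_id hN hsπ h0).2 hd⟩

/-- **Relative complement of an elliptic factor.** If an elliptic curve `E` and a simple threefold `T` are isogeny
factors of `X`, then `X ∼ E × B` with `dim B + 1 = dim X` and `T` an isogeny factor of `B` (`Hom(T, E) = 0`, so the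
section of `T` into `E × B` has zero `E`-component — the tree's `avDominatedBy_right_of_forall_hom_eq_zero`).
[cite: MumfordAV1970, §19 Thm. 1 and Cor. 1–2 (pp. 173–174)] -/
theorem exists_prod_isIsogenous_of_avDominatedBy_curve_threefold (hE : E.dim = 1) (hTs : T.IsSimple)
    (hT3 : T.dim = 3) (hEX : AVDominatedBy E X) (hTX : AVDominatedBy T X) :
    ∃ B : AbelianVariety ℂ, B.dim + 1 = X.dim ∧ AbelianVariety.IsIsogenous (E.prod B) X ∧ AVDominatedBy T B := by
  obtain ⟨B, hdim, g, hg⟩ := exists_prod_isIsogenous_of_avDominatedBy hEX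
  refine ⟨B, by omega, ⟨g, hg⟩, avDominatedBy_right_of_forall_hom_eq_zero (hTX.trans_isIsogeny_inv hg) ?_⟩
  exact hom_eq_zero_of_isSimple_of_lt_dim hTs (by omega)

/-- **FOURFOLDS — the printed shape of case (a)**: if an elliptic curve `E` and a simple threefold `T` are isogeny
factors of a fourfold `X`, then `X ∼ E × T` («`X` is isogenous to a product `X₁ × X₂`»).
[cite: MoonenZarhin1999LowDim, Thm. 0.1 with case (a)] [cite: MumfordAV1970, §19 Thm. 1 and Cor. 1–2 (pp. 173–174)] -/
theorem isIsogenous_curve_prod_threefold_of_avDominatedBy_of_dim_eq_four (hX4 : X.dim = 4) (hE : E.dim = 1)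
    (hTs : T.IsSimple) (hT3 : T.dim = 3) (hEX : AVDominatedBy E X) (hTX : AVDominatedBy T X) :
    AbelianVariety.IsIsogenous X (E.prod T) := by
  obtain ⟨B, hB, hEB, hTB⟩ := exists_prod_isIsogenous_of_avDominatedBy_curve_threefold hE hTs hT3 hEX hTX
  have hBT : AbelianVariety.IsIsogenous B T :=
    isIsogenous_of_avDominatedBy_of_isSimple_of_dim_eq hTB hTs (by omega) (by omega)
  exact hEB.symm'.trans ((AbelianVariety.IsIsogenous.refl E).prod hBT)

/-- **FIVEFOLDS — the printed shapes of cases (e)/(f)**: if an elliptic curve `E` and a simple threefold `T` are isogeny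
factors of a fivefold `X`, then `X ∼ C × (E × T)` for an elliptic curve `C` (the complement of `T` in the complement of
`E`; `X ∼ E × B ∼ E × (T × C) ∼ C × (E × T)`). Case (e) is `C ∼ E`, case (f) is `C ≁ E`.
[cite: MoonenZarhin1999LowDim, Thm. 0.2 with cases (e), (f)] [cite: MumfordAV1970, §19 Thm. 1 and Cor. 1–2 (pp. 173–174)] -/
theorem exists_isIsogenous_curve_prod_of_avDominatedBy_of_dim_eq_five (hX5 : X.dim = 5) (hE : E.dim = 1)
    (hTs : T.IsSimple) (hT3 : T.dim = 3) (hEX : AVDominatedBy E X) (hTX : AVDominatedBy T X) :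
    ∃ C : AbelianVariety ℂ, C.dim = 1 ∧ AbelianVariety.IsIsogenous X (C.prod (E.prod T)) := by
  obtain ⟨B, hB, hEB, hTB⟩ := exists_prod_isIsogenous_of_avDominatedBy_curve_threefold hE hTs hT3 hEX hTX
  obtain ⟨C, hdim, hTC⟩ := exists_prod_isIsogenous_of_avDominatedBy hTB
  refine ⟨C, by omega, ?_⟩
  exact hEB.symm'.trans <| ((AbelianVariety.IsIsogenous.refl E).prod
    (hTC.symm'.trans (isIsogenous_prod_comm T C))).trans (isIsogenous_prod_leftComm E C T)

/-! ### §2 Case (a) and case (f), granted Markman's fourfold theorem alone -/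

/-- **THE HODGE CONJECTURE FOR `E × T` IN CASE (a), GRANTED MARKMAN'S THEOREM ALONE.** `E` an elliptic curve with
complex multiplication `χ ≫ χ = -d` (`d > 0`), `T` a simple abelian threefold, `j : End⁰(E) →+* End⁰(T)` («an
embedding `k ↪ End⁰(X₂)`»); `hMark` = the tree's named fact `Markman2025_weilClasses_algebraic_abelianFourfold`
(hypothesis). By (5.3) (`finrank_endAlgebra_eq_two_or_isOfCMType_of_dim_eq_three_of_ringHom`): (a1)
`dim_ℚ End⁰(T) = 2` — Thm. 0.1 (1) read for HC, the tree's
`hodgeConjectureFor_prod_cmCurve_of_unitaryTwoOne_of_weilClassesFourfold`, whose data are PRODUCED from `j`: an honest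
`φ : T ⟶ T` with `φ ≫ φ = -(M²d) = (Mχ) ≫ (Mχ)` (`exists_hom_comp_self_eq_neg_of_ringHom`), multiplicities `{1,2}` on
`H^{1,0}(T)` (both positive on a simple `T` — Shimura's Prop. 14, `eigenMultiplicity_pos_of_isSimple` —, sum `3`) and
the sign of `± Mχ` matched (`eigenMultiplicity_neg`); (a2) `T` of CM type — `E × T` is a CM FOURFOLD, and HC_CM in
dimension `≤ 5` is a consequence of `hMark` (`CMWeights.hodgeConjectureFor_of_isOfCMType_dim_le_five_of_markman`).
[cite: MoonenZarhin1999LowDim, Thm. 0.1 (1) with case (a) and §5 (5.3)] [claim: Markman2025SurveySecant, status: under-review]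
[cite: Milne1999, §2 p. 54] -/
theorem hodgeConjectureFor_cmCurve_prod_simpleThreefold_of_markman
    (hMark : Markman2025_weilClasses_algebraic_abelianFourfold) (hE : E.dim = 1) (χ : E ⟶ E) {d : ℕ}
    (hd : 0 < d) (hχ : χ ≫ χ = -(d • 𝟙 E)) (hTs : T.IsSimple) (hT3 : T.dim = 3)
    (j : E.endAlgebra →+* T.endAlgebra) : HodgeConjectureFor (E.prod T).dim (E.prod T).X := by
  rcases finrank_endAlgebra_eq_two_or_isOfCMType_of_dim_eq_three_of_ringHom hTs hT3 hd hχ j with h2 | hcm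
  · -- (a1): the Weil classes of the fourfold `T × E`
    obtain ⟨φ, M, hM, hφ, hχM, -⟩ := exists_hom_comp_self_eq_neg_of_ringHom hχ j
    have hdM : 0 < M ^ 2 * d := Nat.mul_pos (pow_pos hM 2) hd
    have hsum := eigenMultiplicity_add_eigenMultiplicity_neg_eq_dim T φ hdM hφ
    rw [hT3] at hsum
    obtain ⟨ha, hb⟩ := AbelianVariety.eigenMultiplicity_pos_of_isSimple T hTs φ hdM hφ (by omega)
    have hsum₁ := eigenMultiplicity_add_eigenMultiplicity_neg_eq_dim E (M • χ) hdM hχM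
    rw [hE] at hsum₁
    have hχ' : (-(M • χ)) ≫ (-(M • χ)) = -((M ^ 2 * d) • 𝟙 E) := by
      rw [Preadditive.neg_comp, Preadditive.comp_neg, neg_neg, hχM]
    -- given an eigenvalue `μ₀` of multiplicity `1` for `φ`, match the curve's sign and conclude on `T × E ∼ E × T`
    have key : ∀ μ₀ : ℂ, (μ₀ = Complex.I * (Real.sqrt (M ^ 2 * d : ℕ) : ℂ) ∨
        μ₀ = -(Complex.I * (Real.sqrt (M ^ 2 * d : ℕ) : ℂ))) → eigenMultiplicity T φ μ₀ = 1 →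
        eigenMultiplicity E (M • χ) μ₀ + eigenMultiplicity E (M • χ) (-μ₀) = 1 →
        HodgeConjectureFor (E.prod T).dim (E.prod T).X := by
      intro μ₀ hμ₀ hmT hs₁
      refine HodgeConjectureFor.of_isIsogenous (isIsogenous_prod_swap E T) ?_
      rcases Nat.eq_zero_or_pos (eigenMultiplicity E (M • χ) μ₀) with h0 | hpos
      · have hm₁ : eigenMultiplicity E (-(M • χ)) μ₀ = 1 := by rw [eigenMultiplicity_neg]; omega
        exact hodgeConjectureFor_prod_cmCurve_of_unitaryTwoOne_of_weilClassesFourfold hMark hT3 h2 φ hdM hφ hμ₀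
          hmT hE (-(M • χ)) hχ' hm₁
      · exact hodgeConjectureFor_prod_cmCurve_of_unitaryTwoOne_of_weilClassesFourfold hMark hT3 h2 φ hdM hφ hμ₀
          hmT hE (M • χ) hχM (by omega)
    rcases (show eigenMultiplicity T φ (Complex.I * (Real.sqrt (M ^ 2 * d : ℕ) : ℂ)) = 1 ∨
        eigenMultiplicity T φ (-(Complex.I * (Real.sqrt (M ^ 2 * d : ℕ) : ℂ))) = 1 by omega) with h1 | h1
    · exact key _ (Or.inl rfl) h1 hsum₁
    · exact key _ (Or.inr rfl) h1 (by rw [neg_neg, add_comm]; exact hsum₁)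
  · -- (a2): `E × T` is of CM type, of dimension `4 ≤ 5`
    exact hodgeConjectureFor_of_isOfCMType_dim_le_five_of_markman hMark (E.prod T)
      ((isOfCMType_of_hom_comp_self_eq_neg hE hd hχ).prod hcm) (by rw [dim_prod]; omega)

/-- … **and for everything isogenous to `E × T`** — case (a) EXACTLY AS PRINTED («`X` is isogenous to a product
`X₁ × X₂`»), with `E` of CM type in the cell's spelling (`IsOfCMType E`; its complex multiplication from the tree's
`exists_hom_comp_self_eq_neg_of_cmCurve`) and `Nonempty (End⁰(E) →+* End⁰(T))`, granted `hMark` alone.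
[cite: MoonenZarhin1999LowDim, Thm. 0.1 (1) with case (a)] [cite: vanGeemen1994HodgeAV, Lemma 3.7]
[claim: Markman2025SurveySecant, status: under-review] -/
theorem hodgeConjectureFor_of_isIsogenous_caseA_of_markman (hMark : Markman2025_weilClasses_algebraic_abelianFourfold)
    (hX : AbelianVariety.IsIsogenous X (E.prod T)) (hE : E.dim = 1) (hEcm : IsOfCMType E) (hTs : T.IsSimple)
    (hT3 : T.dim = 3) (hj : Nonempty (E.endAlgebra →+* T.endAlgebra)) : HodgeConjectureFor X.dim X.X := by
  obtain ⟨j⟩ := hj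
  obtain ⟨χ, d, hd, hχ⟩ := exists_hom_comp_self_eq_neg_of_cmCurve hE hEcm
  exact HodgeConjectureFor.of_isIsogenous hX
    (hodgeConjectureFor_cmCurve_prod_simpleThreefold_of_markman hMark hE χ hd hχ hTs hT3 j)

/-- **THE HODGE CONJECTURE FOR `X₀ × X₁ × X₂` IN CASE (f), GRANTED MARKMAN'S THEOREM ALONE.** `X₀`, `X₁` elliptic curves,
`X₀ ≁ X₁`, `χ₁ ≫ χ₁ = -d₁` on `X₁`, `X₂` a simple threefold, `j : End⁰(X₁) →+* End⁰(X₂)`. Thm. 0.2 (2) (product span,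
the Literature theorem `hodgeConjectureFor_caseF_of_dim_eq_three_of_hodgeConjectureFor`, fed with the honest pair
`φ ≫ φ = -(M²d₁) = (Mχ₁) ≫ (Mχ₁)` from `j`) reduces it to `HC(X₁ × X₂)`, which is case (a) above. Compared with
`CaseF.hodgeConjectureFor_caseF` (lit g63 R34) the hypothesis HC_CM is GONE (absorbed by `hMark` in dimension `4`).
[cite: MoonenZarhin1999LowDim, Thm. 0.2 (2) with case (f)] [claim: Markman2025SurveySecant, status: under-review] -/
theorem hodgeConjectureFor_caseF_of_markman {X₀ X₁ X₂ : AbelianVariety ℂ}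
    (hMark : Markman2025_weilClasses_algebraic_abelianFourfold)
    (hX₀ : X₀.dim = 1) (hX₁ : X₁.dim = 1) (hni : ¬ AbelianVariety.IsIsogenous X₀ X₁) (χ₁ : X₁ ⟶ X₁) {d₁ : ℕ}
    (hd₁ : 0 < d₁) (hχ₁ : χ₁ ≫ χ₁ = -(d₁ • 𝟙 X₁)) (hX₂ : X₂.IsSimple) (hX₂3 : X₂.dim = 3)
    (j : X₁.endAlgebra →+* X₂.endAlgebra) :
    HodgeConjectureFor (X₀.prod (X₁.prod X₂)).dim (X₀.prod (X₁.prod X₂)).X := by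
  obtain ⟨φ, M, hM, hφ, hχM, -⟩ := exists_hom_comp_self_eq_neg_of_ringHom hχ₁ j
  exact hodgeConjectureFor_caseF_of_dim_eq_three_of_hodgeConjectureFor hX₀ hX₁ hni (M • χ₁)
    (Nat.mul_pos (pow_pos hM 2) hd₁) hχM hX₂ hX₂3 φ hφ
    (hodgeConjectureFor_cmCurve_prod_simpleThreefold_of_markman hMark hX₁ χ₁ hd₁ hχ₁ hX₂ hX₂3 j)

/-- … **and for every `X` isogenous to `X₀ × E × T` of case (f)** (cell's spelling: `IsOfCMType E`, `X₀ ≁ E`,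
`Nonempty (End⁰(E) →+* End⁰(T))`), granted `hMark` alone. [cite: MoonenZarhin1999LowDim, Thm. 0.2 (2) with case (f)]
[cite: vanGeemen1994HodgeAV, Lemma 3.7] [claim: Markman2025SurveySecant, status: under-review] -/
theorem hodgeConjectureFor_of_isIsogenous_caseF_of_markman {X₀ : AbelianVariety ℂ}
    (hMark : Markman2025_weilClasses_algebraic_abelianFourfold)
    (hX : AbelianVariety.IsIsogenous X (X₀.prod (E.prod T))) (hX₀ : X₀.dim = 1) (hE : E.dim = 1)
    (hEcm : IsOfCMType E) (hni : ¬ AbelianVariety.IsIsogenous X₀ E) (hTs : T.IsSimple) (hT3 : T.dim = 3)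
    (hj : Nonempty (E.endAlgebra →+* T.endAlgebra)) : HodgeConjectureFor X.dim X.X := by
  obtain ⟨j⟩ := hj
  obtain ⟨χ, d, hd, hχ⟩ := exists_hom_comp_self_eq_neg_of_cmCurve hE hEcm
  exact HodgeConjectureFor.of_isIsogenous hX (hodgeConjectureFor_caseF_of_markman hMark hX₀ hE hni χ hd hχ hTs hT3 j)

/-! ### §3 Fourfolds -/

/-- **EVERY NON-SIMPLE COMPLEX ABELIAN FOURFOLD SATISFIES THE HODGE CONJECTURE, GRANTED MARKMAN'S THEOREM ON THE WEIL
CLASSES OF ABELIAN FOURFOLDS** — no further hypothesis. Outside case (a) (no elliptic curve `E` of CM type and simple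
threefold `T`, both isogeny factors of `X`, with `End⁰(E) ↪ End⁰(T)`): Moonen–Zarhin Thm. 0.1 (4), UNCONDITIONAL in
the tree (`NonSimpleFourfolds.isStablyNondegenerate_of_dim_eq_four_of_not_isSimple_of_not_caseA`); in case (a):
`X ∼ E × T` (§1) and §2. [cite: MoonenZarhin1999LowDim, Thm. 0.1 (1), (4) with case (a)]
[cite: MumfordAV1970, §19 Thm. 1 (pp. 173–174)] [claim: Markman2025SurveySecant, status: under-review] -/
theorem hodgeConjectureFor_of_dim_eq_four_of_not_isSimple_of_markman
    (hMark : Markman2025_weilClasses_algebraic_abelianFourfold) (hX4 : X.dim = 4) (hX : ¬ X.IsSimple) :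
    HodgeConjectureFor X.dim X.X := by
  by_cases hna : ∃ E T : AbelianVariety ℂ, E.dim = 1 ∧ IsOfCMType E ∧ T.IsSimple ∧ T.dim = 3 ∧
      AVDominatedBy E X ∧ AVDominatedBy T X ∧ Nonempty (E.endAlgebra →+* T.endAlgebra)
  · obtain ⟨E, T, hE, hEcm, hTs, hT3, hEX, hTX, hj⟩ := hna
    exact hodgeConjectureFor_of_isIsogenous_caseA_of_markman hMark
      (isIsogenous_curve_prod_threefold_of_avDominatedBy_of_dim_eq_four hX4 hE hTs hT3 hEX hTX) hE hEcm hTs hT3 hj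
  · exact (isStablyNondegenerate_of_dim_eq_four_of_not_isSimple_of_not_caseA hX4 hX hna).hodgeConjectureFor

/-- **Every complex abelian fourfold that is non-simple OR of CM type satisfies the Hodge conjecture, granted Markman's
theorem** (simple CM fourfolds: `CMWeights.hodgeConjectureFor_of_isOfCMType_dim_le_five_of_markman`). The residual
row — simple fourfolds not of CM type (Moonen–Zarhin 1995) — is not a theorem of the tree.
[cite: MoonenZarhin1999LowDim, Thm. 0.1] [claim: Markman2025SurveySecant, status: under-review] -/
theorem hodgeConjectureFor_of_dim_eq_four_of_markman (hMark : Markman2025_weilClasses_algebraic_abelianFourfold)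
    (hX4 : X.dim = 4) (hs : X.IsSimple → IsOfCMType X) : HodgeConjectureFor X.dim X.X := by
  by_cases hX : X.IsSimple
  · exact hodgeConjectureFor_of_isOfCMType_dim_le_five_of_markman hMark X (hs hX) (by omega)
  · exact hodgeConjectureFor_of_dim_eq_four_of_not_isSimple_of_markman hMark hX4 hX

/-! ### §4 Fivefolds -/

/-- **THE HODGE CONJECTURE FOR NON-SIMPLE COMPLEX ABELIAN FIVEFOLDS, GRANTED MARKMAN'S THEOREM** — for every non-simple
fivefold `X` WITHOUT simple isogeny factor of dimension `4` and OUTSIDE the single row «`X ∼ E × E × T` with `E` an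
elliptic curve of CM type, `T` a simple threefold with `dim_ℚ End⁰(T) = 2` and `End⁰(E) ↪ End⁰(T)`» (case (e) with
(a1), whose Thm. 0.2 (1) — the pull-backs `W_{k,α}` — is not a theorem of the tree). Outside (e)/(f): Thm. 0.2 (4),
UNCONDITIONAL in the tree (`NonSimpleFivefolds.hodgeConjectureFor_of_dim_eq_five_of_not_isSimple`); otherwise
`X ∼ C × (E × T)` (§1): `C ≁ E` is case (f) (§2); `C ∼ E` with `T` of CM type makes `X ∼ E² × T` a CM fivefold
(`CMWeights.hodgeConjectureFor_of_isOfCMType_dim_le_five_of_markman`); `C ∼ E` with `dim_ℚ End⁰(T) = 2` is the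
excluded row, by (5.3). [cite: MoonenZarhin1999LowDim, Thm. 0.2 (2), (4) with cases (e), (f) and §5 (5.3)]
[cite: MumfordAV1970, §19 Thm. 1 (pp. 173–174)] [cite: Milne1999, §2 p. 54] [claim: Markman2025SurveySecant, status: under-review] -/
theorem hodgeConjectureFor_of_dim_eq_five_of_not_isSimple_of_markman
    (hMark : Markman2025_weilClasses_algebraic_abelianFourfold) (hX5 : X.dim = 5) (hX : ¬ X.IsSimple)
    (h4 : ∀ F : AbelianVariety ℂ, F.IsSimple → F.dim = 4 → ¬ AVDominatedBy F X)
    (hne : ¬ ∃ E T : AbelianVariety ℂ, E.dim = 1 ∧ IsOfCMType E ∧ T.IsSimple ∧ T.dim = 3 ∧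
      Module.finrank ℚ T.endAlgebra = 2 ∧ Nonempty (E.endAlgebra →+* T.endAlgebra) ∧
      AbelianVariety.IsIsogenous X (E.prod (E.prod T))) :
    HodgeConjectureFor X.dim X.X := by
  by_cases hna : ∃ E T : AbelianVariety ℂ, E.dim = 1 ∧ IsOfCMType E ∧ T.IsSimple ∧ T.dim = 3 ∧
      AVDominatedBy E X ∧ AVDominatedBy T X ∧ Nonempty (E.endAlgebra →+* T.endAlgebra)
  · obtain ⟨E, T, hE, hEcm, hTs, hT3, hEX, hTX, ⟨j⟩⟩ := hna
    obtain ⟨C, hC, hXC⟩ := exists_isIsogenous_curve_prod_of_avDominatedBy_of_dim_eq_five hX5 hE hTs hT3 hEX hTX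
    obtain ⟨χ, d, hd, hχ⟩ := exists_hom_comp_self_eq_neg_of_cmCurve hE hEcm
    by_cases hCE : AbelianVariety.IsIsogenous C E
    · -- case (e): `X ∼ E × E × T`
      have hXE : AbelianVariety.IsIsogenous X (E.prod (E.prod T)) :=
        hXC.trans (hCE.prod (AbelianVariety.IsIsogenous.refl _))
      rcases finrank_endAlgebra_eq_two_or_isOfCMType_of_dim_eq_three_of_ringHom hTs hT3 hd hχ j with h2 | hTcm
      · exact absurd ⟨E, T, hE, hEcm, hTs, hT3, h2, ⟨j⟩, hXE⟩ hne
      · exact hodgeConjectureFor_of_isOfCMType_dim_le_five_of_markman hMark X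
          (isOfCMType_of_avDominatedBy (hEcm.prod (hEcm.prod hTcm))
            (AVDominatedBy.of_isIsogenous hXE (AVDominatedBy.refl _))) (by omega)
    · -- case (f): `X ∼ C × E × T`, `C ≁ E`
      exact HodgeConjectureFor.of_isIsogenous hXC (hodgeConjectureFor_caseF_of_markman hMark hC hE hCE χ hd hχ hTs hT3 j)
  · exact hodgeConjectureFor_of_dim_eq_five_of_not_isSimple hX5 hX h4 hna

/-! ### §5 Dimension `≤ 5` -/

/-- **THE HODGE CONJECTURE IN DIMENSION `≤ 5`, GRANTED MARKMAN'S THEOREM ON THE WEIL CLASSES OF ABELIAN FOURFOLDS, OUTSIDE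
FOUR PRINTED ROWS.** For every complex abelian variety `X` with `dim X ≤ 5` such that (i) if `X` is SIMPLE of
dimension `4` or `5` then `X` is of CM type [residual: Moonen–Zarhin 1995 for simple fourfolds, Tankeev–Ribet for
simple fivefolds — typed in the tree as named facts only], (ii) if `dim X = 5`, no simple fourfold is an isogeny factor
of `X` [residual: Thm. 0.2 (3)–(4) with case (g)], (iii) if `dim X = 5`, `X` is not `∼ E² × T` with `T` a simple
threefold, `dim_ℚ End⁰(T) = 2`, `End⁰(E) ↪ End⁰(T)` [residual: Thm. 0.2 (1)] — the Hodge conjecture holds for `X`.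
Dimension `≤ 3`: unconditional (`hodgeConjectureFor_of_dim_le_three_holds`); `4`: §3; `5`: §4 and the CM slice.
[cite: MoonenZarhin1999LowDim, Thm. 0.1 and Thm. 0.2] [claim: Markman2025SurveySecant, status: under-review] [cite: Deligne2000, §1] -/
theorem hodgeConjectureFor_of_dim_le_five_of_markman (hMark : Markman2025_weilClasses_algebraic_abelianFourfold)
    (h5 : X.dim ≤ 5) (hs : 4 ≤ X.dim → X.IsSimple → IsOfCMType X)
    (h4 : X.dim = 5 → ∀ F : AbelianVariety ℂ, F.IsSimple → F.dim = 4 → ¬ AVDominatedBy F X)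
    (hne : X.dim = 5 → ¬ ∃ E T : AbelianVariety ℂ, E.dim = 1 ∧ IsOfCMType E ∧ T.IsSimple ∧ T.dim = 3 ∧
      Module.finrank ℚ T.endAlgebra = 2 ∧ Nonempty (E.endAlgebra →+* T.endAlgebra) ∧
      AbelianVariety.IsIsogenous X (E.prod (E.prod T))) :
    HodgeConjectureFor X.dim X.X := by
  rcases (show X.dim ≤ 3 ∨ X.dim = 4 ∨ X.dim = 5 by omega) with h3 | h4' | h5'
  · exact hodgeConjectureFor_of_dim_le_three_holds h3 isSmoothProjective_holds
  · exact hodgeConjectureFor_of_dim_eq_four_of_markman hMark h4' (hs (by omega))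
  · by_cases hX : X.IsSimple
    · exact hodgeConjectureFor_of_isOfCMType_dim_le_five_of_markman hMark X (hs (by omega) hX) h5
    · exact hodgeConjectureFor_of_dim_eq_five_of_not_isSimple_of_markman hMark h5' hX (h4 h5') (hne h5')

/-- **Class target: the Hodge conjecture on the class of complex abelian varieties of dimension `≤ 5` outside the four
residual rows, from Markman's fourfold theorem alone.** [cite: MoonenZarhin1999LowDim, Thm. 0.1 and Thm. 0.2]
[cite: Deligne2000, §1] [claim: Markman2025SurveySecant, status: under-review] -/
theorem hcOnClass_dim_le_five_of_markman (hMark : Markman2025_weilClasses_algebraic_abelianFourfold) :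
    HCOnClass fun X => X.dim ≤ 5 ∧ (4 ≤ X.dim → X.IsSimple → IsOfCMType X) ∧
      (X.dim = 5 → ∀ F : AbelianVariety ℂ, F.IsSimple → F.dim = 4 → ¬ AVDominatedBy F X) ∧
      (X.dim = 5 → ¬ ∃ E T : AbelianVariety ℂ, E.dim = 1 ∧ IsOfCMType E ∧ T.IsSimple ∧ T.dim = 3 ∧
        Module.finrank ℚ T.endAlgebra = 2 ∧ Nonempty (E.endAlgebra →+* T.endAlgebra) ∧
        AbelianVariety.IsIsogenous X (E.prod (E.prod T))) :=
  fun _ ⟨h5, hs, h4, hne⟩ => hodgeConjectureFor_of_dim_le_five_of_markman hMark h5 hs h4 hne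

/-- **Class target, non-simple fourfolds**: the Hodge conjecture on ALL non-simple complex abelian fourfolds, from
Markman's fourfold theorem alone. [cite: MoonenZarhin1999LowDim, Thm. 0.1] [cite: Deligne2000, §1]
[claim: Markman2025SurveySecant, status: under-review] -/
theorem hcOnClass_nonSimpleFourfolds_of_markman (hMark : Markman2025_weilClasses_algebraic_abelianFourfold) :
    HCOnClass fun X => X.dim = 4 ∧ ¬ X.IsSimple :=
  fun _ ⟨h4, hX⟩ => hodgeConjectureFor_of_dim_eq_four_of_not_isSimple_of_markman hMark h4 hX

/-- **On path**: the Hodge conjecture (summit form) gives both class targets — they are CASES of the summit, reduced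
above to Markman's fourfold theorem. [cite: Deligne2000, §1] -/
theorem hcOnClass_dim_le_five_of_hodgeConjecture
    (h : ∀ ⦃n : ℕ⦄ ⦃Y : Literature.AlgebraicGeometry.Motives.SchemeOver ℂ⦄,
      Literature.AlgebraicGeometry.Motives.IsSmoothProjective n Y → HodgeConjectureFor n Y) :
    HCOnClass fun X => X.dim ≤ 5 ∧ (4 ≤ X.dim → X.IsSimple → IsOfCMType X) ∧
      (X.dim = 5 → ∀ F : AbelianVariety ℂ, F.IsSimple → F.dim = 4 → ¬ AVDominatedBy F X) ∧
      (X.dim = 5 → ¬ ∃ E T : AbelianVariety ℂ, E.dim = 1 ∧ IsOfCMType E ∧ T.IsSimple ∧ T.dim = 3 ∧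
        Module.finrank ℚ T.endAlgebra = 2 ∧ Nonempty (E.endAlgebra →+* T.endAlgebra) ∧
        AbelianVariety.IsIsogenous X (E.prod (E.prod T))) :=
  fun _ _ => h isSmoothProjective_holds

end Summit.HodgeConjecture.Ring2.LowDimOfMarkman

end
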